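import Literature.Topology.FourManifolds.CancellationGlue
import Literature.Topology.FourManifolds.RegularSlabField
import HarnessLib

/-!
# Milnor 1965, proof of Thm. 5.4, Assertion 6: the construction of `ḡ` under the
# supposition — proved (`Cobordism.Milnor1965_cancellation_glueCharts_holds`)

Topic `Literature/Topology/FourManifolds` (fact seat
`provefact-Literature.Topology.FourManifolds.Cobord-05c749f4e5`, tenure on
`Literature.Topology.FourManifolds.Cobordism.Milnor1965_cancellation_preliminaryHypothesis`;
fourth and last file of the infrastructure for the leaf
`Literature.Topology.FourManifolds.Cobordism.Milnor1965_cancellation_glueCharts` of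
`HCobordismModelChart.lean`, which it **discharges**).

Milnor, *Lectures on the h-cobordism theorem* (1965), proof of Thm. 5.4, Assertion 6 (held
copy, PDF p. 31): the flow box `L₀` swept out by the trajectories of `η⃗` *"with initial
points in a small neighborhood `U₁` of `g₁⁻¹(p₁)` in `g₁⁻¹f⁻¹(b₁)`"*, the extension `ḡ₁` of
`g₁` to `L₁ ∪ L₀`, and, under the supposition that `ḡ₁` and `g₂` agree near `g₂⁻¹(p₂)`, the
diffeomorphism `ḡ = ḡ₁ ∪ g₂` with `ḡ⁎η⃗ = kξ`.  The chart `ḡ⁻¹` and the factor `k` were built in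
`CancellationFlowBox.lean` and `CancellationGlue.lean` from a
`Literature.Topology.FourManifolds.Cobordism.FlowBoxSetting`; here the setting is produced from
the hypotheses of the named fact:

* the slab `f⁻¹[u, w] = f⁻¹[b₁ - δ, b₂ + δ]` without critical values (`δ` from the finiteness of
  the critical set, `RegularSlabField.lean`) and its slab flow (`SlabDynamics.lean`);
* **the trajectory of `p₁` runs inside the domain of `g₁⁻¹` from the level `u` up to `p₁`**
  (`flow_p₁_mem_lower_source`: it is the `g₁`-image of the model axis, by the transfer of
  integral curves and backward uniqueness) and, under the supposition at `p₁`, **inside the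
  domain of `g₂⁻¹` from the level `b₂` up to the level `w`** (`flow_p₁_mem_upper_source`:
  the translate of `p₁` to the level `b₂` is `p₂ = g₂(t₂e₀)`, from where the trajectory is the
  `g₂`-image of the axis);
* a tube argument (`exists_nhds_Icc_of_forall_mem`) and the continuity of the hitting times
  spread both containments to the trajectories of the points of a neighbourhood of `p₁`, and the
  joint openness of the hitting condition of the model flow (`CancellationFlowLines.lean`)
  gives Milnor's *"small neighborhood `U₁`"* `S`;
* `Literature.Topology.FourManifolds.Cobordism.Milnor1965_cancellation_glueCharts_holds` — the
  named fact, from `FlowBoxSetting.isCancellationModel_gluedChart`.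

## References

* J. Milnor, *Lectures on the h-cobordism theorem*, notes by L. Siebenmann and J. Sondow,
  Princeton Mathematical Notes (1965): proof of Thm. 5.4, Assertion 6 (PDF pp. 30–31).  Held:
  `lit read book:milnornd-lectures-h-cobordism-theorem`. [MilnorHCobordism1965]
-/

open scoped Manifold ContDiff Topology
open Set Function Filter

noncomputable section

namespace Literature.Topology.FourManifolds

open Flow

universe u

/-! ### Backward uniqueness of integral curves; a tube lemma for flows -/

section General

variable {E : Type*} [NormedAddCommGroup E] [NormedSpace ℝ E] {H : Type*} [TopologicalSpace H]
  {I : ModelWithCorners ℝ E H} {X : Type*} [TopologicalSpace X] [ChartedSpace H X]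

/-- **Backward uniqueness of integral curves on a closed interval**: two integral curves of a
`C¹` field on `[a, b]` which agree at the final time `b` agree on `[a, b]` (reverse time and
apply forward uniqueness, `isMIntegralCurveOn_Icc_eqOn_of_contMDiff_left`, to `-v`). [folklore] -/
theorem isMIntegralCurveOn_Icc_eqOn_of_contMDiff_right [IsManifold I 1 X] [T2Space X]
    {v : Π x : X, TangentSpace I x} (hv : ContMDiff I I.tangent 1 fun x => (⟨x, v x⟩ : TangentBundle I X))
    {γ γ' : ℝ → X} {a b : ℝ} (hγ : IsMIntegralCurveOn γ v (Icc a b))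
    (hγ' : IsMIntegralCurveOn γ' v (Icc a b)) (h : γ b = γ' b) : EqOn γ γ' (Icc a b) := by
  have hrev : ∀ {c : ℝ → X}, IsMIntegralCurveOn c v (Icc a b) →
      IsMIntegralCurveOn (c ∘ Neg.neg) (-v) (Icc (-b) (-a)) := by
    intro c hc
    rw [isMIntegralCurveOn_comp_neg_iff]
    refine hc.mono fun s hs => ?_
    simp only [mem_preimage, mem_Icc] at hs ⊢
    constructor <;> linarith [hs.1, hs.2]
  have heq : EqOn (γ ∘ Neg.neg) (γ' ∘ Neg.neg) (Icc (-b) (-a)) :=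
    isMIntegralCurveOn_Icc_eqOn_of_contMDiff_left hv.neg_section (hrev hγ) (hrev hγ') (by simp [h])
  intro t ht
  have := heq (x := -t) ⟨by linarith [ht.2], by linarith [ht.1]⟩
  simpa using this

omit [ChartedSpace H X] in
/-- **Tube lemma for a continuous flow along a compact time interval**: if `θ(t, x) ∈ O` (open)
for all `t ∈ [a, b]`, then `θ(t, y) ∈ O` for all `t ∈ [a - ε, b + ε]` and all `y` near `x`, for
some `ε > 0`. [folklore] -/
theorem exists_nhds_Icc_of_forall_mem {θ : ℝ × X → X} (hθ : Continuous θ) {O : Set X}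
    (hO : IsOpen O) {a b : ℝ} {x : X} (h : ∀ t ∈ Icc a b, θ (t, x) ∈ O) :
    ∃ ε > (0 : ℝ), ∃ V ∈ 𝓝 x, ∀ t ∈ Icc (a - ε) (b + ε), ∀ y ∈ V, θ (t, y) ∈ O := by
  rcases lt_or_ge b a with hba | hab
  · refine ⟨(a - b) / 3, by linarith, univ, univ_mem, fun t ht => ?_⟩
    exact absurd (ht.1.trans ht.2) (by linarith)
  -- an open rectangle `U × V ⊇ [a, b] × {x}` inside `θ⁻¹(O)`
  have hsub : Icc a b ×ˢ ({x} : Set X) ⊆ θ ⁻¹' O := by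
    rintro ⟨t, y⟩ ⟨ht, hy⟩
    rw [mem_singleton_iff] at hy
    subst hy
    exact h t ht
  obtain ⟨U, V, hU, hV, haU, hxV, hUV⟩ :=
    generalized_tube_lemma isCompact_Icc isCompact_singleton (hO.preimage hθ) hsub
  -- `U ⊇ [a - ε, b + ε]`
  obtain ⟨ε₁, hε₁, hε₁U⟩ := Metric.isOpen_iff.1 hU a (haU (left_mem_Icc.2 hab))
  obtain ⟨ε₂, hε₂, hε₂U⟩ := Metric.isOpen_iff.1 hU b (haU (right_mem_Icc.2 hab))
  refine ⟨min ε₁ ε₂ / 2, by positivity, V, hV.mem_nhds (hxV (mem_singleton x)), fun t ht y hy => ?_⟩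
  have htU : t ∈ U := by
    rcases lt_or_ge t a with hta | hta
    · apply hε₁U
      rw [Metric.mem_ball, Real.dist_eq, abs_lt]
      constructor <;> linarith [ht.1, min_le_left ε₁ ε₂]
    rcases le_or_gt t b with htb | htb
    · exact haU ⟨hta, htb⟩
    · apply hε₂U
      rw [Metric.mem_ball, Real.dist_eq, abs_lt]
      constructor <;> linarith [ht.2, min_le_right ε₁ ε₂]
  exact hUV (mk_mem_prod htU hy)

end General

/-! ### The trajectory of `p₁` lies in the domains of the two charts -/

variable {n : ℕ} {M N : Type u} [TopologicalSpace M] [ChartedSpace (EuclideanSpace ℝ (Fin n)) M]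
  [TopologicalSpace N] [ChartedSpace (EuclideanSpace ℝ (Fin n)) N]

namespace Cobordism

namespace SlabFlow

variable {c : Cobordism n M N} {f : c.W → ℝ} {ξ : Π x : c.W, TangentSpace (𝓡∂ (n + 1)) x}
  {u w : ℝ} {θ : ℝ × c.W → c.W} (hθ : SlabFlow c f ξ u w θ)
  (hreg : ∀ z, IsMCriticalPt (𝓡∂ (n + 1)) f z → f z ∉ Icc u w)
  {k : ℕ} {v : ℝ → ℝ} (hv : IsCancellationProfile v) {p p' : c.W} {b₁ b₂ t₁ t₂ : ℝ}
  {G₁ G₂ : OpenPartialHomeomorph c.W (EuclideanSpace ℝ (Fin (n + 1)))}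

include hθ hreg hv

omit hv in
/-- A time before the hitting time of a level lies below the level, so a point of the
trajectory with `a ≤ f` is at a time `≥ τ_a` (transversal levels of the slab). [folklore] -/
theorem hittingTime_le_of_le_apply {z : c.W} (hz : f z ∈ Icc u w) {a : ℝ} (ha : a ∈ Icc u w)
    {t : ℝ} (hat : a ≤ f (θ (t, z))) : hittingTime θ f a z ≤ t := by
  by_contra hlt
  rw [not_le] at hlt
  have hmono := hθ.monotone z hlt.le
  simp only at hmono
  rw [apply_hittingTime (hθ.hits hreg hz ha)] at hmono
  have heq : f (θ (t, z)) = a := le_antisymm hmono hat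
  have := hθ.isSmoothFlow.hittingTime_unique hθ.mdifferentiable_f (hθ.transversal hreg ha) heq
  exact absurd this (ne_of_gt hlt)

omit hv in
/-- Dually, a point of the trajectory with `f ≤ a` is at a time `≤ τ_a`. [folklore] -/
theorem le_hittingTime_of_apply_le {z : c.W} (hz : f z ∈ Icc u w) {a : ℝ} (ha : a ∈ Icc u w)
    {t : ℝ} (hta : f (θ (t, z)) ≤ a) : t ≤ hittingTime θ f a z := by
  by_contra hlt
  rw [not_le] at hlt
  have hmono := hθ.monotone z hlt.le
  simp only at hmono
  rw [apply_hittingTime (hθ.hits hreg hz ha)] at hmono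
  have heq : f (θ (t, z)) = a := le_antisymm hta hmono
  have := hθ.isSmoothFlow.hittingTime_unique hθ.mdifferentiable_f (hθ.transversal hreg ha) heq
  exact absurd this (ne_of_lt hlt)

/-- **The trajectory of `p₁ = g₁(t₁e₀)` runs inside the domain of `g₁⁻¹` from the level `u` up
to `p₁`** (Milnor: *"the image of `L₁` is a neighborhood in `f⁻¹[a₁, b₁]` of the segment
`pp₁` of `T`"*).  The model axis flow line `σ(s)e₀` of `t₁e₀`, run backwards down to the level
`u > F(0)`, stays on the segment `[0, t₁e₀] ⊆ G₁.target`; its `g₁`-image is a trajectory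
segment of `ξ` ending at `p₁` (the chart carries `ξ` to `η⃗` where `f ≤ b₁`), hence by backward
uniqueness it is the flow segment of `p₁`, which therefore lies in `G₁.source`.
[cite: MilnorHCobordism1965, proof of Thm. 5.4, Assertion 6, (a), (b) (PDF pp. 30–31)] -/
theorem flow_p₁_mem_lower_source (hG₁ : IsLowerCancellationChart (𝓡∂ (n + 1)) f ξ p k G₁ v b₁ t₁)
    (hpu : f p < u) (hub : u < b₁) (hbw : b₁ ≤ w) {t : ℝ}
    (ht : t ∈ Icc (hittingTime θ f u (G₁.symm (t₁ • EuclideanSpace.single (0 : Fin (n + 1)) (1 : ℝ)))) 0) :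
    θ (t, G₁.symm (t₁ • EuclideanSpace.single (0 : Fin (n + 1)) (1 : ℝ))) ∈ G₁.source := by
  set e₀ : EuclideanSpace ℝ (Fin (n + 1)) := EuclideanSpace.single (0 : Fin (n + 1)) (1 : ℝ) with he₀
  set x₁ : EuclideanSpace ℝ (Fin (n + 1)) := t₁ • e₀ with hx₁
  set p₁ : c.W := G₁.symm x₁ with hp₁
  have hx₁t : x₁ ∈ G₁.target := hG₁.segment_subset (right_mem_segment ℝ _ _)
  have hp₁s : p₁ ∈ G₁.source := G₁.map_target hx₁t
  have hGp₁ : G₁ p₁ = x₁ := G₁.right_inv hx₁t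
  have hfp₁ : f p₁ = b₁ := hG₁.apply_symm_smul_single
  have ht₁ : t₁ ∈ Ioo (0 : ℝ) 1 := ⟨hG₁.pos, hG₁.lt_one⟩
  have hx₁0 : x₁ 0 ∈ Ioo (0 : ℝ) 1 := by simpa [hx₁, he₀] using ht₁
  have huI : u ∈ Icc u w := ⟨le_rfl, hub.le.trans hbw⟩
  have hb₁I : b₁ ∈ Icc u w := ⟨hub.le, hbw⟩
  have hfp₁I : f p₁ ∈ Icc u w := by rw [hfp₁]; exact hb₁I
  -- the Morse function of the modified profile along the axis
  have hFx₁ : milnorCancellationMorse k (lipschitzProfile v) (f p) x₁ = b₁ := by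
    rw [morse_lipschitzProfile_eq_of_mem_Ioo k (f p) hx₁0]; exact hG₁.apply_smul_single
  have hFe₀ : milnorCancellationMorse k (lipschitzProfile v) (f p) ((1 : ℝ) • e₀) =
      f p + 2 * ∫ s in (0 : ℝ)..1, v s := by
    simpa [he₀] using morse_lipschitzProfile_smul_single (m := n + 1) k (f p) (s := 1) ⟨by norm_num, by norm_num⟩
  have hmonoF := strictMonoOn_milnorCancellationMorse_smul_single (m := n + 1) k hv.lipschitzProfile (f p)
  have hb₁top : b₁ < f p + 2 * ∫ s in (0 : ℝ)..1, v s := by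
    have := hmonoF ⟨ht₁.1.le, ht₁.2.le⟩ ⟨zero_le_one, le_rfl⟩ ht₁.2
    simp only [← he₀] at this
    rwa [← hx₁, hFx₁, hFe₀] at this
  have hulev : u ∈ Ioo (f p) (f p + 2 * ∫ s in (0 : ℝ)..1, v s) := ⟨hpu, hub.trans hb₁top⟩
  -- the model axis flow line of `x₁` down to the level `u`
  have hhits : Hits (cancellationFlow k v hv) (milnorCancellationMorse k (lipschitzProfile v) (f p)) u x₁ :=
    hits_smul_single_of_mem_Ioo k hv (f p) ht₁ hulev
  set S₀ := cancellationLevelTime k v hv (f p) u x₁ with hS₀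
  have hFS₀ : milnorCancellationMorse k (lipschitzProfile v) (f p) (cancellationFlow k v hv (S₀, x₁)) = u :=
    apply_cancellationLevelProj k hv (f p) hhits
  have hmono : Monotone fun s => milnorCancellationMorse k (lipschitzProfile v) (f p) (cancellationFlow k v hv (s, x₁)) :=
    monotone_milnorCancellationMorse_modelFlow k _ (contDiff_lipschitzProfile hv.contDiff).continuous (f p) x₁
  have hS₀0 : S₀ ≤ 0 := by
    by_contra hpos
    rw [not_le] at hpos
    have := hmono hpos.le
    simp only [cancellationFlow, modelFlow_zero] at this
    rw [hFx₁] at this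
    rw [cancellationFlow_eq_modelFlow] at hFS₀
    rw [hFS₀] at this
    exact absurd this (not_le.2 hub)
  -- the flow line stays on the segment `[0, t₁e₀] ⊆ G₁.target` on `[S₀, 0]`, below `b₁`
  have haxis : ∀ s, cancellationFlow k v hv (s, x₁) = (cancellationFlow k v hv (s, x₁) 0) • e₀ ∧
      cancellationFlow k v hv (s, x₁) 0 ∈ Ioo (0 : ℝ) 1 := fun s => cancellationFlow_smul_single k hv ht₁ s
  have hlevel_le : ∀ s ∈ Icc S₀ 0, milnorCancellationMorse k (lipschitzProfile v) (f p) (cancellationFlow k v hv (s, x₁)) ≤ b₁ := by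
    intro s hs
    have := hmono hs.2
    simp only at this
    rwa [show cancellationFlow k v hv (0, x₁) = x₁ from modelFlow_zero k _ x₁, hFx₁] at this
  have hseg : ∀ s ∈ Icc S₀ 0, cancellationFlow k v hv (s, x₁) ∈ G₁.target := by
    intro s hs
    obtain ⟨hform, hσ⟩ := haxis s
    set σ := cancellationFlow k v hv (s, x₁) 0 with hσdef
    have hσt : σ ≤ t₁ := by
      have hle := hlevel_le s hs
      rw [hform, ← hFx₁, hx₁] at hle
      exact (hmonoF.le_iff_le ⟨hσ.1.le, hσ.2.le⟩ ⟨ht₁.1.le, ht₁.2.le⟩).1 hle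
    rw [hform]
    refine hG₁.segment_subset ⟨1 - σ / t₁, σ / t₁, by rw [sub_nonneg]; exact (div_le_one ht₁.1).2 hσt,
      div_nonneg hσ.1.le ht₁.1.le, by ring, ?_⟩
    rw [smul_zero, zero_add, ← he₀, smul_smul, div_mul_cancel₀ _ ht₁.1.ne']
  -- its `g₁`-image is a trajectory segment of `ξ` ending at `p₁`
  have hG₁md : G₁.MDifferentiable (𝓡∂ (n + 1)) 𝓘(ℝ, EuclideanSpace ℝ (Fin (n + 1))) :=
    ⟨hG₁.contMDiffOn.mdifferentiableOn (by simp), hG₁.contMDiffOn_symm.mdifferentiableOn (by simp)⟩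
  have hderiv : ∀ s ∈ Icc S₀ 0, HasDerivWithinAt (fun s => cancellationFlow k v hv (s, x₁))
      (milnorCancellationField k v (cancellationFlow k v hv (s, x₁))) (Icc S₀ 0) s := by
    intro s _
    have h1 : HasDerivAt (fun s => cancellationFlow k v hv (s, x₁))
        (milnorCancellationField k (lipschitzProfile v) (cancellationFlow k v hv (s, x₁))) s :=
      hasDerivAt_modelFlow k (exists_lipschitzWith_lipschitzProfile hv.contDiff) x₁ s
    rw [field_lipschitzProfile_eq_of_mem_Ioo k (haxis s).2] at h1
    exact h1.hasDerivWithinAt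
  have hchart : ∀ s ∈ Icc S₀ 0, mfderiv (𝓡∂ (n + 1)) 𝓘(ℝ, EuclideanSpace ℝ (Fin (n + 1))) G₁
      (G₁.symm (cancellationFlow k v hv (s, x₁))) (ξ (G₁.symm (cancellationFlow k v hv (s, x₁)))) =
      milnorCancellationField k v (cancellationFlow k v hv (s, x₁)) := by
    intro s hs
    have hsrc : G₁.symm (cancellationFlow k v hv (s, x₁)) ∈ G₁.source := G₁.map_target (hseg s hs)
    have h1 := hG₁.mfderiv_apply_eq _ hsrc (by
      rw [hG₁.apply_eq _ hsrc, G₁.right_inv (hseg s hs), ← morse_lipschitzProfile_eq_of_mem_Ioo k (f p) (haxis s).2]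
      exact hlevel_le s hs)
    rwa [G₁.right_inv (hseg s hs)] at h1
  have hγ : IsMIntegralCurveOn (G₁.symm ∘ fun s => cancellationFlow k v hv (s, x₁)) ξ (Icc S₀ 0) :=
    isMIntegralCurveOn_symm_comp_of_hasDerivWithinAt_of_forall hG₁md hderiv (fun s hs => hseg s hs) hchart
  -- the flow segment of `p₁` from the level `u`
  set T₀ := hittingTime θ f u p₁ with hT₀
  have hT₀0 : T₀ ≤ 0 := hθ.hittingTime_nonpos hreg hfp₁I huI (by rw [hfp₁]; exact hub.le)
  have hfT₀ : f (θ (T₀, p₁)) = u := apply_hittingTime (hθ.hits hreg hfp₁I huI)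
  have hθcurve : IsMIntegralCurveOn (fun s => θ (s, p₁)) ξ (Icc T₀ 0) :=
    hθ.isMIntegralCurveOn_Icc (by rw [hfT₀]) (by rw [hθ.isSmoothFlow.map_zero, hfp₁]; exact hbw)
  -- they agree on `[max S₀ T₀, 0]`
  set m := max S₀ T₀ with hm
  have hm0 : m ≤ 0 := max_le hS₀0 hT₀0
  have heq : EqOn (fun s => θ (s, p₁)) (G₁.symm ∘ fun s => cancellationFlow k v hv (s, x₁)) (Icc m 0) :=
    isMIntegralCurveOn_Icc_eqOn_of_contMDiff_right hθ.contMDiff_one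
      (hθcurve.mono (Icc_subset_Icc_left (le_max_right _ _)))
      (hγ.mono (Icc_subset_Icc_left (le_max_left _ _)))
      (by simp [hθ.isSmoothFlow.map_zero, cancellationFlow_eq_modelFlow, hp₁])
  -- hence `S₀ ≤ T₀`
  have hST : S₀ ≤ T₀ := by
    by_contra hlt
    rw [not_le] at hlt
    have hmS : m = S₀ := max_eq_left hlt.le
    have h1 := heq ⟨le_of_eq hmS, hS₀0⟩
    simp only [comp_apply] at h1
    have hlevel : f (θ (S₀, p₁)) = u := by
      rw [h1, hG₁.apply_eq _ (G₁.map_target (hseg S₀ ⟨le_rfl, hS₀0⟩)), G₁.right_inv (hseg S₀ ⟨le_rfl, hS₀0⟩),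
        ← morse_lipschitzProfile_eq_of_mem_Ioo k (f p) (haxis S₀).2]
      exact hFS₀
    have := hθ.isSmoothFlow.hittingTime_unique hθ.mdifferentiable_f (hθ.transversal hreg huI) hlevel
    exact absurd this (ne_of_lt hlt)
  have hmT : m = T₀ := max_eq_right hST
  -- conclusion
  have htm : t ∈ Icc m 0 := by rw [hmT]; exact ht
  have h1 := heq htm
  simp only [comp_apply] at h1
  rw [h1]
  exact G₁.map_target (hseg t ⟨(le_max_left _ _).trans htm.1, htm.2⟩)

/-- **Under the supposition at `p₁`, the trajectory of `p₁` runs inside the domain of `g₂⁻¹`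
from the level `b₂` up to the level `w`** (Milnor: *"the image of `L₂` is a neighborhood in
`f⁻¹[b₂, a₂]` of the segment `p₂p'` of `T`"*).  The translate `y₂` of `p₁` to the level `b₂`
lies in `G₂.source` and `G₂ y₂` is the translate of `t₁e₀` along the axis, i.e. `t₂e₀`; the
model axis flow line of `t₂e₀` up to the level `w < F(e₀)` stays on the segment
`[t₂e₀, e₀] ⊆ G₂.target`, and its `g₂`-image is the trajectory of `y₂` (the chart carries `ξ`
to `η⃗` where `f ≥ b₂`; forward uniqueness). [cite: MilnorHCobordism1965, proof of Thm. 5.4, Assertion 6, (a), (b) and the supposition (PDF pp. 30–31)] -/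
theorem flow_p₁_mem_upper_source (hG₁ : IsLowerCancellationChart (𝓡∂ (n + 1)) f ξ p k G₁ v b₁ t₁)
    (hG₂ : IsUpperCancellationChart (𝓡∂ (n + 1)) f ξ p p' k G₂ v b₂ t₂)
    (hub : u ≤ b₁) (hb : b₁ < b₂) (hbw : b₂ < w) (hwp : w < f p')
    (hsup : ∀ y, f y = b₂ → FlowsTo (𝓡∂ (n + 1)) ξ (G₁.symm (t₁ • EuclideanSpace.single (0 : Fin (n + 1)) (1 : ℝ))) y →
      y ∈ G₂.source ∧ FlowsTo 𝓘(ℝ, EuclideanSpace ℝ (Fin (n + 1)))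
        (fun x : EuclideanSpace ℝ (Fin (n + 1)) =>
          (milnorCancellationField k v x : TangentSpace 𝓘(ℝ, EuclideanSpace ℝ (Fin (n + 1))) x))
        (G₁ (G₁.symm (t₁ • EuclideanSpace.single (0 : Fin (n + 1)) (1 : ℝ)))) (G₂ y))
    {t : ℝ}
    (ht : t ∈ Icc (hittingTime θ f b₂ (G₁.symm (t₁ • EuclideanSpace.single (0 : Fin (n + 1)) (1 : ℝ))))
      (hittingTime θ f w (G₁.symm (t₁ • EuclideanSpace.single (0 : Fin (n + 1)) (1 : ℝ))))) :
    θ (t, G₁.symm (t₁ • EuclideanSpace.single (0 : Fin (n + 1)) (1 : ℝ))) ∈ G₂.source := by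
  set e₀ : EuclideanSpace ℝ (Fin (n + 1)) := EuclideanSpace.single (0 : Fin (n + 1)) (1 : ℝ) with he₀
  set x₁ : EuclideanSpace ℝ (Fin (n + 1)) := t₁ • e₀ with hx₁
  set p₁ : c.W := G₁.symm x₁ with hp₁
  have hx₁t : x₁ ∈ G₁.target := hG₁.segment_subset (right_mem_segment ℝ _ _)
  have hGp₁ : G₁ p₁ = x₁ := G₁.right_inv hx₁t
  have hfp₁ : f p₁ = b₁ := hG₁.apply_symm_smul_single
  have ht₁ : t₁ ∈ Ioo (0 : ℝ) 1 := ⟨hG₁.pos, hG₁.lt_one⟩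
  have ht₂ : t₂ ∈ Ioo (0 : ℝ) 1 := ⟨hG₂.pos, hG₂.lt_one⟩
  have hx₁0 : x₁ 0 ∈ Ioo (0 : ℝ) 1 := by simpa [hx₁, he₀] using ht₁
  have hb₁I : b₁ ∈ Icc u w := ⟨hub, (hb.trans hbw).le⟩
  have hb₂I : b₂ ∈ Icc u w := ⟨hub.trans hb.le, hbw.le⟩
  have hwI : w ∈ Icc u w := ⟨hub.trans (hb.trans hbw).le, le_rfl⟩
  have hfp₁I : f p₁ ∈ Icc u w := by rw [hfp₁]; exact hb₁I
  have hfp' : f p' = f p + 2 * ∫ s in (0 : ℝ)..1, v s := by linarith [hG₂.two_mul_integral_eq]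
  have hmonoF := strictMonoOn_milnorCancellationMorse_smul_single (m := n + 1) k hv.lipschitzProfile (f p)
  have hFt₂ : milnorCancellationMorse k (lipschitzProfile v) (f p) (t₂ • e₀) = b₂ := by
    rw [morse_lipschitzProfile_eq_of_mem_Ioo k (f p) (by simpa [he₀] using ht₂)]; exact hG₂.apply_smul_single
  have hpb : f p < b₂ := by
    have h0 : milnorCancellationMorse k (lipschitzProfile v) (f p) ((0 : ℝ) • e₀) = f p := by simp
    have := hmonoF ⟨le_rfl, zero_le_one⟩ ⟨ht₂.1.le, ht₂.2.le⟩ ht₂.1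
    simp only [← he₀] at this
    rwa [h0, hFt₂] at this
  -- the translate `y₂` of `p₁` to the level `b₂`, and the supposition
  set T₂ := hittingTime θ f b₂ p₁ with hT₂
  set T₃ := hittingTime θ f w p₁ with hT₃
  have hT₂0 : 0 ≤ T₂ := hθ.hittingTime_nonneg hreg hfp₁I hb₂I (by rw [hfp₁]; exact hb.le)
  have hfT₂ : f (θ (T₂, p₁)) = b₂ := apply_hittingTime (hθ.hits hreg hfp₁I hb₂I)
  have hfT₃ : f (θ (T₃, p₁)) = w := apply_hittingTime (hθ.hits hreg hfp₁I hwI)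
  have hT₂₃ : T₂ ≤ T₃ := hθ.hittingTime_le_of_le_apply hreg hfp₁I hb₂I (by rw [hfT₃]; exact hbw.le)
  have hflows : FlowsTo (𝓡∂ (n + 1)) ξ p₁ (θ (T₂, p₁)) :=
    hθ.flowsTo_levelProj' hreg hfp₁I hb₂I (by rw [hfp₁]; exact hb.le)
  obtain ⟨hy₂s, hmodel⟩ := hsup _ hfT₂ hflows
  rw [hGp₁] at hmodel
  obtain ⟨T', -, hT'⟩ := exists_cancellationFlow_eq_of_flowsTo k hv hx₁0 hmodel
  -- `G₂ y₂ = t₂e₀`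
  have hGy₂ : G₂ (θ (T₂, p₁)) = t₂ • e₀ := by
    obtain ⟨hform, hσ⟩ := cancellationFlow_smul_single (m := n + 1) k hv ht₁ T'
    rw [← hx₁, hT'] at hform hσ
    have hlevel : milnorCancellationMorse k (lipschitzProfile v) (f p)
        ((G₂ (θ (T₂, p₁)) 0) • e₀) = b₂ := by
      rw [← hform, morse_lipschitzProfile_eq_of_mem_Ioo k (f p) (by rw [hform]; simpa [he₀] using hσ),
        ← hG₂.apply_eq _ hy₂s]
      exact hfT₂
    have hσt : G₂ (θ (T₂, p₁)) 0 = t₂ := by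
      apply smul_single_injOn_morse (m := n + 1) k hv (f p) ⟨hσ.1.le, hσ.2.le⟩ ⟨ht₂.1.le, ht₂.2.le⟩
      show milnorCancellationMorse k (lipschitzProfile v) (f p)
          ((G₂ (θ (T₂, p₁)) 0) • EuclideanSpace.single (0 : Fin (n + 1)) (1 : ℝ)) =
        milnorCancellationMorse k (lipschitzProfile v) (f p) (t₂ • EuclideanSpace.single (0 : Fin (n + 1)) (1 : ℝ))
      rw [← he₀, hlevel, hFt₂]
    rw [hform, hσt]
  set x₂ : EuclideanSpace ℝ (Fin (n + 1)) := t₂ • e₀ with hx₂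
  have hx₂0 : x₂ 0 ∈ Ioo (0 : ℝ) 1 := by simpa [hx₂, he₀] using ht₂
  have hy₂eq : G₂.symm x₂ = θ (T₂, p₁) := by rw [← hGy₂, G₂.left_inv hy₂s]
  -- the model axis flow line of `x₂` up to the level `w`
  have hwlev : w ∈ Ioo (f p) (f p + 2 * ∫ s in (0 : ℝ)..1, v s) := ⟨hpb.trans hbw, by rw [← hfp']; exact hwp⟩
  have hhits : Hits (cancellationFlow k v hv) (milnorCancellationMorse k (lipschitzProfile v) (f p)) w x₂ :=
    hits_smul_single_of_mem_Ioo k hv (f p) ht₂ hwlev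
  set S₃ := cancellationLevelTime k v hv (f p) w x₂ with hS₃
  have hFS₃ : milnorCancellationMorse k (lipschitzProfile v) (f p) (cancellationFlow k v hv (S₃, x₂)) = w :=
    apply_cancellationLevelProj k hv (f p) hhits
  have hFx₂ : milnorCancellationMorse k (lipschitzProfile v) (f p) x₂ = b₂ := hFt₂
  have hS₃0 : 0 ≤ S₃ := cancellationLevelTime_nonneg k hv (f p) hx₂0 (by rw [hFx₂]; exact hbw.le) hhits
  have hmono : Monotone fun s => milnorCancellationMorse k (lipschitzProfile v) (f p) (cancellationFlow k v hv (s, x₂)) :=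
    monotone_milnorCancellationMorse_modelFlow k _ (contDiff_lipschitzProfile hv.contDiff).continuous (f p) x₂
  have haxis : ∀ s, cancellationFlow k v hv (s, x₂) = (cancellationFlow k v hv (s, x₂) 0) • e₀ ∧
      cancellationFlow k v hv (s, x₂) 0 ∈ Ioo (0 : ℝ) 1 := fun s => cancellationFlow_smul_single k hv ht₂ s
  have hlevel_ge : ∀ s ∈ Icc 0 S₃, b₂ ≤ milnorCancellationMorse k (lipschitzProfile v) (f p) (cancellationFlow k v hv (s, x₂)) := by
    intro s hs
    have := hmono hs.1
    simp only at this
    rwa [show cancellationFlow k v hv (0, x₂) = x₂ from modelFlow_zero k _ x₂, hFx₂] at this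
  have hseg : ∀ s ∈ Icc 0 S₃, cancellationFlow k v hv (s, x₂) ∈ G₂.target := by
    intro s hs
    obtain ⟨hform, hσ⟩ := haxis s
    set σ := cancellationFlow k v hv (s, x₂) 0 with hσdef
    have hσt : t₂ ≤ σ := by
      have hle := hlevel_ge s hs
      rw [hform, ← hFt₂] at hle
      exact (hmonoF.le_iff_le ⟨ht₂.1.le, ht₂.2.le⟩ ⟨hσ.1.le, hσ.2.le⟩).1 hle
    have h1t₂ : 0 < 1 - t₂ := by linarith [ht₂.2]
    rw [hform]
    refine hG₂.segment_subset ⟨(1 - σ) / (1 - t₂), (σ - t₂) / (1 - t₂), div_nonneg (by linarith [hσ.2]) h1t₂.le,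
      div_nonneg (by linarith) h1t₂.le, ?_, ?_⟩
    · field_simp; ring
    · rw [← he₀, smul_smul]
      nth_rw 2 [← one_smul ℝ e₀]
      rw [smul_smul, mul_one, ← add_smul]
      congr 1
      field_simp
      ring
  -- its `g₂`-image is a trajectory segment of `ξ` from `y₂`
  have hG₂md : G₂.MDifferentiable (𝓡∂ (n + 1)) 𝓘(ℝ, EuclideanSpace ℝ (Fin (n + 1))) :=
    ⟨hG₂.contMDiffOn.mdifferentiableOn (by simp), hG₂.contMDiffOn_symm.mdifferentiableOn (by simp)⟩
  have hderiv : ∀ s ∈ Icc 0 S₃, HasDerivWithinAt (fun s => cancellationFlow k v hv (s, x₂))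
      (milnorCancellationField k v (cancellationFlow k v hv (s, x₂))) (Icc 0 S₃) s := by
    intro s _
    have h1 : HasDerivAt (fun s => cancellationFlow k v hv (s, x₂))
        (milnorCancellationField k (lipschitzProfile v) (cancellationFlow k v hv (s, x₂))) s :=
      hasDerivAt_modelFlow k (exists_lipschitzWith_lipschitzProfile hv.contDiff) x₂ s
    rw [field_lipschitzProfile_eq_of_mem_Ioo k (haxis s).2] at h1
    exact h1.hasDerivWithinAt
  have hchart : ∀ s ∈ Icc 0 S₃, mfderiv (𝓡∂ (n + 1)) 𝓘(ℝ, EuclideanSpace ℝ (Fin (n + 1))) G₂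
      (G₂.symm (cancellationFlow k v hv (s, x₂))) (ξ (G₂.symm (cancellationFlow k v hv (s, x₂)))) =
      milnorCancellationField k v (cancellationFlow k v hv (s, x₂)) := by
    intro s hs
    have hsrc : G₂.symm (cancellationFlow k v hv (s, x₂)) ∈ G₂.source := G₂.map_target (hseg s hs)
    have h1 := hG₂.mfderiv_apply_eq _ hsrc (by
      rw [hG₂.apply_eq _ hsrc, G₂.right_inv (hseg s hs), ← morse_lipschitzProfile_eq_of_mem_Ioo k (f p) (haxis s).2]
      exact hlevel_ge s hs)
    rwa [G₂.right_inv (hseg s hs)] at h1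
  have hγ : IsMIntegralCurveOn (G₂.symm ∘ fun s => cancellationFlow k v hv (s, x₂)) ξ (Icc 0 S₃) :=
    isMIntegralCurveOn_symm_comp_of_hasDerivWithinAt_of_forall hG₂md hderiv (fun s hs => hseg s hs) hchart
  -- the flow segment of `y₂` up to the level `w`
  have hθcurve : IsMIntegralCurveOn (fun s => θ (s, θ (T₂, p₁))) ξ (Icc 0 (T₃ - T₂)) := by
    refine hθ.isMIntegralCurveOn_Icc ?_ ?_
    · rw [hθ.isSmoothFlow.map_zero, hfT₂]; exact hb₂I.1
    · rw [hθ.isSmoothFlow.map_add, sub_add_cancel, hfT₃]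
  -- they agree on `[0, min S₃ (T₃ - T₂)]`
  set m := min S₃ (T₃ - T₂) with hm
  have hm0 : 0 ≤ m := le_min hS₃0 (sub_nonneg.2 hT₂₃)
  have heq : EqOn (fun s => θ (s, θ (T₂, p₁))) (G₂.symm ∘ fun s => cancellationFlow k v hv (s, x₂)) (Icc 0 m) :=
    isMIntegralCurveOn_Icc_eqOn_of_contMDiff_left hθ.contMDiff_one
      (hθcurve.mono (Icc_subset_Icc_right (min_le_right _ _)))
      (hγ.mono (Icc_subset_Icc_right (min_le_left _ _)))
      (by simp [hθ.isSmoothFlow.map_zero, cancellationFlow_eq_modelFlow, hy₂eq])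
  -- hence `T₃ - T₂ ≤ S₃`
  have hST : T₃ - T₂ ≤ S₃ := by
    by_contra hlt
    rw [not_le] at hlt
    have hmS : m = S₃ := min_eq_left hlt.le
    have h1 := heq ⟨hS₃0, le_of_eq hmS.symm⟩
    simp only [comp_apply] at h1
    have hlevel : f (θ (S₃ + T₂, p₁)) = w := by
      rw [← hθ.isSmoothFlow.map_add, h1, hG₂.apply_eq _ (G₂.map_target (hseg S₃ ⟨hS₃0, le_rfl⟩)),
        G₂.right_inv (hseg S₃ ⟨hS₃0, le_rfl⟩), ← morse_lipschitzProfile_eq_of_mem_Ioo k (f p) (haxis S₃).2]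
      exact hFS₃
    have := hθ.isSmoothFlow.hittingTime_unique hθ.mdifferentiable_f (hθ.transversal hreg hwI) hlevel
    rw [← hT₃] at this
    linarith
  have hmT : m = T₃ - T₂ := min_eq_right hST
  -- conclusion
  have hs : t - T₂ ∈ Icc 0 m := by rw [hmT]; exact ⟨sub_nonneg.2 ht.1, sub_le_sub_right ht.2 _⟩
  have hsplit : θ (t, p₁) = θ (t - T₂, θ (T₂, p₁)) := by rw [hθ.isSmoothFlow.map_add, sub_add_cancel]
  have h1 := heq hs
  simp only [comp_apply] at h1
  rw [hsplit, h1]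
  exact G₂.map_target (hseg (t - T₂) ⟨hs.1, (min_le_left _ _).trans' hs.2⟩)

end SlabFlow

/-! ### The named fact -/

/-- **Milnor 1965, proof of Thm. 5.4, Assertion 6, the construction of `ḡ` under the
supposition — proved**, discharging
`Literature.Topology.FourManifolds.Cobordism.Milnor1965_cancellation_glueCharts`.  From the
hypotheses a flow-box setting (`Literature.Topology.FourManifolds.Cobordism.FlowBoxSetting`) is
assembled — the slab `f⁻¹[b₁ - δ, b₂ + δ]` without critical values and its slab flow, and
Milnor's *"small neighborhood `U₁` of `p₁`"* cut down so that the model flow lines meet all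
levels of the slab, the trajectories stay in the domains of `g₁⁻¹` below and of `g₂⁻¹` above
(`flow_p₁_mem_lower_source`, `flow_p₁_mem_upper_source`, a tube argument and the continuity of
the hitting times), and the supposition holds —, and the glued chart `ḡ⁻¹ = (ḡ₁ ∪ g₂)⁻¹` with
Milnor's `k` is a cancellation model (`FlowBoxSetting.isCancellationModel_gluedChart`) with
domain in the slab `f⁻¹(a₀, a₁)`. [cite: MilnorHCobordism1965, proof of Thm. 5.4, Assertion 6 (PDF pp. 30–31)] -/
theorem Milnor1965_cancellation_glueCharts_holds : Cobordism.Milnor1965_cancellation_glueCharts.{u} := by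
  intro n M N _ _ _ _ _ _ _ _ _ _ _ _ c f hf ξ hξ a₀ a₁ ha₀ ha₁ p p' k v hv b₁ b₂ t₁ t₂ hb₁ hb₁₂ hb₂ hreg
    G₁ G₂ hG₁ hG₂ hG₁slab hG₂slab hagree
  have hξs : ContMDiff (𝓡∂ (n + 1)) (𝓡∂ (n + 1)).tangent ∞
      fun x => (⟨x, ξ x⟩ : TangentBundle (𝓡∂ (n + 1)) c.W) := ξ.contMDiff
  have hfC : ContMDiff (𝓡∂ (n + 1)) 𝓘(ℝ, ℝ) ∞ f := hf.1.contMDiff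
  have hp₀ : a₀ < f p := (hG₁slab hG₁.mem_source).1
  have hp'₁ : f p' < a₁ := (hG₂slab hG₂.mem_source).2
  -- `δ`: no critical value in `[b₁ - δ, b₂ + δ]`, `f p < b₁ - δ`, `b₂ + δ < f p'`
  obtain ⟨δ₀, hδ₀, hδ₀reg⟩ := exists_pos_forall_mem_Icc_mfderiv_ne_zero (I := 𝓡∂ (n + 1)) hfC
    (a := b₁) (b := b₂) (fun x hx hc => hreg x hc hx)
  set δ := min δ₀ (min ((b₁ - f p) / 2) ((f p' - b₂) / 2)) with hδ
  have hδpos : 0 < δ := lt_min hδ₀ (lt_min (by linarith) (by linarith))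
  have hδ₁ : δ ≤ δ₀ := min_le_left _ _
  have hδ₂ : δ ≤ (b₁ - f p) / 2 := (min_le_right _ _).trans (min_le_left _ _)
  have hδ₃ : δ ≤ (f p' - b₂) / 2 := (min_le_right _ _).trans (min_le_right _ _)
  set u := b₁ - δ with hu
  set w := b₂ + δ with hw
  have hpu : f p < u := by rw [hu]; linarith
  have hub : u < b₁ := by rw [hu]; linarith
  have hbw : b₂ < w := by rw [hw]; linarith
  have hwp : w < f p' := by rw [hw]; linarith
  have hu0 : 0 < u := ha₀.trans (hp₀.trans hpu)
  have hw1 : w < 1 := hwp.trans (hp'₁.trans ha₁)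
  have huw : u < w := hub.trans (hb₁₂.trans hbw)
  have hregθ : ∀ z, IsMCriticalPt (𝓡∂ (n + 1)) f z → f z ∉ Icc u w := fun z hz hfz =>
    hδ₀reg z ⟨by rw [hu] at hfz; linarith [hfz.1], by rw [hw] at hfz; linarith [hfz.2]⟩ hz
  obtain ⟨θ, hθ⟩ := IsMorseFunction.exists_slabFlow hf hξs hξ hu0 huw hw1
  have huI : u ∈ Icc u w := ⟨le_rfl, huw.le⟩
  have hwI : w ∈ Icc u w := ⟨huw.le, le_rfl⟩
  have hb₁I : b₁ ∈ Icc u w := ⟨hub.le, (hb₁₂.trans hbw).le⟩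
  have hb₂I : b₂ ∈ Icc u w := ⟨(hub.trans hb₁₂).le, hbw.le⟩
  -- `p₁`
  set e₀ : EuclideanSpace ℝ (Fin (n + 1)) := EuclideanSpace.single (0 : Fin (n + 1)) (1 : ℝ) with he₀
  set p₁ : c.W := G₁.symm (t₁ • e₀) with hp₁
  have hx₁t : t₁ • e₀ ∈ G₁.target := hG₁.segment_subset (right_mem_segment ℝ _ _)
  have hp₁s : p₁ ∈ G₁.source := G₁.map_target hx₁t
  have hGp₁ : G₁ p₁ = t₁ • e₀ := G₁.right_inv hx₁t
  have hfp₁ : f p₁ = b₁ := hG₁.apply_symm_smul_single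
  have hfp₁I : f p₁ ∈ Icc u w := by rw [hfp₁]; exact hb₁I
  have ht₁ : t₁ ∈ Ioo (0 : ℝ) 1 := ⟨hG₁.pos, hG₁.lt_one⟩
  have hfp' : f p' = f p + 2 * ∫ s in (0 : ℝ)..1, v s := by linarith [hG₂.two_mul_integral_eq]
  have hlevels : Icc u w ⊆ Ioo (f p) (f p + 2 * ∫ s in (0 : ℝ)..1, v s) := fun a ha =>
    ⟨hpu.trans_le ha.1, by rw [← hfp']; exact ha.2.trans_lt hwp⟩
  -- the supposition
  obtain ⟨U, hU, hUsrc, hUagree⟩ := hagree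
  have hsupp₁ : ∀ y, f y = b₂ → FlowsTo (𝓡∂ (n + 1)) ξ p₁ y → y ∈ G₂.source ∧
      FlowsTo 𝓘(ℝ, EuclideanSpace ℝ (Fin (n + 1)))
        (fun x : EuclideanSpace ℝ (Fin (n + 1)) =>
          (milnorCancellationField k v x : TangentSpace 𝓘(ℝ, EuclideanSpace ℝ (Fin (n + 1))) x))
        (G₁ p₁) (G₂ y) := fun y hy hfl => hUagree p₁ (mem_of_mem_nhds hU) hfp₁ y hy hfl
  -- `S₀`: inside `G₁.source`, first coordinate in `(0, 1)`
  set S₀ : Set c.W := G₁.source ∩ G₁ ⁻¹' {x | x 0 ∈ Ioo (0 : ℝ) 1} with hS₀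
  have hS₀o : IsOpen S₀ := G₁.isOpen_inter_preimage
    ((EuclideanSpace.proj (𝕜 := ℝ) (0 : Fin (n + 1))).continuous.isOpen_preimage _ isOpen_Ioo)
  have hp₁S₀ : p₁ ∈ S₀ := ⟨hp₁s, by
    show G₁ p₁ 0 ∈ Ioo (0 : ℝ) 1
    rw [hGp₁]; simpa [he₀] using ht₁⟩
  -- `S₂`: the model flow lines meet every level of `[u, w]`
  obtain ⟨O, hO, hOhits⟩ := exists_nhds_forall_hits_of_isCompact k hv (f p) isCompact_Icc hlevels (x := t₁ • e₀)
    fun a ha => hits_smul_single_of_mem_Ioo k hv (f p) ht₁ (hlevels ha)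
  set S₂ : Set c.W := G₁.source ∩ G₁ ⁻¹' interior O with hS₂
  have hS₂o : IsOpen S₂ := G₁.isOpen_inter_preimage isOpen_interior
  have hp₁S₂ : p₁ ∈ S₂ := ⟨hp₁s, by
    show G₁ p₁ ∈ interior O
    rw [hGp₁]; exact mem_interior_iff_mem_nhds.2 hO⟩
  -- `S₃`: trajectories stay in `G₁.source` down to the level `u`
  set T₀ := hittingTime θ f u p₁ with hT₀
  obtain ⟨ε₃, hε₃, V₃, hV₃, hV₃mem⟩ := exists_nhds_Icc_of_forall_mem hθ.isSmoothFlow.continuous G₁.open_source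
    (a := T₀) (b := 0) (x := p₁) fun t ht => hθ.flow_p₁_mem_lower_source hregθ hv hG₁ hpu hub hb₁I.2 ht
  set S₃ : Set c.W := interior {z | z ∈ V₃ ∧ T₀ - ε₃ < hittingTime θ f u z} with hS₃
  have hp₁S₃ : p₁ ∈ S₃ := by
    rw [hS₃, mem_interior_iff_mem_nhds]
    refine Filter.inter_mem hV₃ ?_
    exact (hθ.contMDiffAt_hittingTime' hregθ hfp₁I huI).continuousAt.preimage_mem_nhds
      (Ioi_mem_nhds (by linarith))
  -- `S₄`: trajectories stay in `G₂.source` from the level `b₂` up to `w`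
  set T₂ := hittingTime θ f b₂ p₁ with hT₂
  set T₃ := hittingTime θ f w p₁ with hT₃
  obtain ⟨ε₄, hε₄, V₄, hV₄, hV₄mem⟩ := exists_nhds_Icc_of_forall_mem hθ.isSmoothFlow.continuous G₂.open_source
    (a := T₂) (b := T₃) (x := p₁) fun t ht =>
      hθ.flow_p₁_mem_upper_source hregθ hv hG₁ hG₂ hub.le hb₁₂ hbw hwp hsupp₁ ht
  set S₄ : Set c.W := interior {z | z ∈ V₄ ∧ T₂ - ε₄ < hittingTime θ f b₂ z ∧ hittingTime θ f w z < T₃ + ε₄}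
    with hS₄
  have hp₁S₄ : p₁ ∈ S₄ := by
    rw [hS₄, mem_interior_iff_mem_nhds]
    refine Filter.inter_mem hV₄ (Filter.inter_mem ?_ ?_)
    · exact (hθ.contMDiffAt_hittingTime' hregθ hfp₁I hb₂I).continuousAt.preimage_mem_nhds
        (Ioi_mem_nhds (by linarith))
    · exact (hθ.contMDiffAt_hittingTime' hregθ hfp₁I hwI).continuousAt.preimage_mem_nhds
        (Iio_mem_nhds (by linarith))
  -- Milnor's `U₁`
  set S : Set c.W := S₀ ∩ interior U ∩ S₂ ∩ S₃ ∩ S₄ with hS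
  have hSet : FlowBoxSetting c f ξ k v p p' b₁ b₂ t₁ t₂ u w θ G₁ G₂ S :=
    { slabFlow := hθ
      profile := hv
      lower := hG₁
      upper := hG₂
      lt_u := hpu
      u_lt := hub
      b_lt := hb₁₂
      lt_w := hbw
      w_lt := hwp
      regular := hregθ
      isOpen := (((hS₀o.inter isOpen_interior).inter hS₂o).inter isOpen_interior).inter isOpen_interior
      subset_source := fun z hz => hz.1.1.1.1.1
      symm_smul_single_mem := ⟨⟨⟨⟨hp₁S₀, mem_interior_iff_mem_nhds.2 hU⟩, hp₁S₂⟩, hp₁S₃⟩, hp₁S₄⟩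
      apply_zero_mem := fun z hz => hz.1.1.1.1.2
      hits := fun z hz _ a ha => hOhits (G₁ z) (interior_subset hz.1.1.2.2) a ha
      flow_mem_lower := by
        intro z hz hfz t ht0 hut
        have hz₃ := interior_subset hz.1.2
        have hfzI : f z ∈ Icc u w := by rw [hfz]; exact hb₁I
        have hτ : hittingTime θ f u z ≤ t := hθ.hittingTime_le_of_le_apply hregθ hfzI huI hut
        exact hV₃mem t ⟨by linarith [hz₃.2], by linarith⟩ z hz₃.1
      flow_mem_upper := by
        intro z hz hfz t _ hbt htw
        have hz₄ := interior_subset hz.2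
        have hfzI : f z ∈ Icc u w := by rw [hfz]; exact hb₁I
        have hτ₂ : hittingTime θ f b₂ z ≤ t := hθ.hittingTime_le_of_le_apply hregθ hfzI hb₂I hbt
        have hτ₃ : t ≤ hittingTime θ f w z := hθ.le_hittingTime_of_apply_le hregθ hfzI hwI htw
        exact hV₄mem t ⟨by linarith [hz₄.2.1], by linarith [hz₄.2.2]⟩ z hz₄.1
      agree := fun z hz hfz y hy hfl => hUagree z (interior_subset hz.1.1.1.2) hfz y hy hfl }
  refine ⟨hSet.gluedChart, hSet.gluedFactor, hSet.isCancellationModel_gluedChart, fun q hq => ?_⟩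
  rcases hSet.gluedChart_source_subset hq with (h1 | h1) | h1
  · exact hG₁slab h1
  · exact ⟨(hp₀.trans hpu).trans h1.1.1, h1.1.2.trans (hwp.trans hp'₁)⟩
  · exact hG₂slab h1

end Cobordism

end Literature.Topology.FourManifolds
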